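import Mathlib
import HarnessLib

/-!
# Ventures/CertifiedQuantumChemistry — Rows/ExactLDLDecision.lean: the exact, pivoting-free `LDLᵀ`
# test WITH THE ZERO-PIVOT RULE decides positive semidefiniteness (the block test of the checker of record)

HONEST FRAMING (verbatim): certified bounds for a stated model Hamiltonian in a stated basis; not a
claim about the real molecule beyond that model. Nothing in this file asserts a value, a row or a claim
node about anything; it types an ALGORITHM used by the cell's exact certificate readers.

Seat rdm-B (gen 31), zero compute. Companion of `Rows/ExactEnclosureCertificate.lean` (gen 30), which
types what a `PASS` of the exact enclosure checker `code/qchem_rdm_b/check_enclosure.py` MEANS given that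
every block it accepts is positive semidefinite; THIS file types the one routine that decides that, the
function `ldl_psd` shared by the checker of record and by its symmetry-adapted twin
(`tools/x12-g28/x12e/check_enclosure_sym.py`, whose screen reduces to the same routine on smaller blocks):

```
def ldl_psd(M):                      # M square, symmetric by construction, exact entries
    n = len(M); B = [row[:] for row in M]
    for k in range(n):
        d = B[k][k]
        if d < 0:  return False      # negative pivot: reject
        if d == 0:                   # zero pivot: the column below it must vanish, then skip it
            if any(B[i][k] != 0 for i in range(k+1, n)): return False
            continue
        for i in range(k+1, n):      # positive pivot: eliminate (outer-product / Schur step)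
            f = B[i][k]/d
            for j in range(k+1, n): B[i][j] -= f*B[k][j]
    return True
```

Peeling the first index instead of looping over `k` (the loop only ever reads the trailing block
`B[k:, k:]`, which after a positive pivot IS the Schur complement and after a zero pivot is untouched),
this is the structural recursion `ExactLDL.ldlAccept` below, over ANY linearly ordered field `K`:

* `n = 0`: accept;
* pivot `d = M 0 0 < 0`: reject;
* `d = 0`: accept iff the column below the pivot vanishes AND the trailing minor `M.submatrix succ succ`
  is accepted;
* `d > 0`: continue on the Schur complement `S i j = M i⁺ j⁺ − (M i⁺ 0 / d) · M 0 j⁺`.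

What is PROVED (0 `sorry`; one `def`, the algorithm itself):

* §1 `quadForm_cons` — the quadratic form peeled at index `0` (pure algebra, any commutative ring).
* §2 the THREE BRANCHES as two-sided statements for a Hermitian matrix over a linearly ordered field
  (trivial star): `not_posSemidef_of_pivot_neg`; `posSemidef_iff_of_pivot_eq_zero`
  (`M ⪰ 0 ↔ column = 0 ∧ minor ⪰ 0` — the ZERO-PIVOT RULE, Horn–Johnson Obs. 7.1.10); and
  `posSemidef_iff_schur_of_pivot_pos` (`M ⪰ 0 ↔ S ⪰ 0`, by completing the square
  `xᵀ M x = d (t + c·y/d)² + yᵀ S y`).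
* §3 `ldlAccept` and the DECISION THEOREM `ldlAccept_iff_posSemidef`: for Hermitian `M`,
  `ldlAccept n M = true ↔ M.PosSemidef` — BOTH directions, so a `False` is a refutation and not merely a
  failed factorisation; unconditional corollaries `posSemidef_of_ldlAccept` (needs `M` Hermitian, which the
  readers guarantee by construction: they write `M[a][b]` and `M[b][a]` together) and
  `ldlAccept_of_posSemidef`.
* §4 `ldlAccept_map` — the verdict is invariant under a strictly monotone ring homomorphism of linearly
  ordered fields (only field operations and sign tests are used), whence `ldlAccept_iff_posSemidef_real`:
  running the routine in exact RATIONAL arithmetic decides semidefiniteness of the REAL matrix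
  `M.map Rat.cast` — the form in which `Rows/ExactEnclosureCertificate.lean` consumes the verdict — and
  `posSemidef_rat_iff_real`. (The checker's second number type, `[p, q] = p + q√2 ∈ ℚ(√2) ⊂ ℝ`, is the
  same routine run inside the ordered subfield `ℚ(√2)` of `ℝ`; by `ldlAccept_map` for the subfield
  inclusion its verdict is the real one; its exact SIGN RULE — the checker's `F2.sign` — is typed in the
  companion file `Rows/SqrtTwoSignRule.lean`.)
* §5 kernel-checked examples (`decide +kernel`) exercising every branch, as usage templates.

NOT here (deliberately): the informational second return value of `ldl_psd` (the count of positive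
pivots, printed as `rank`, used by no verdict); floating point (there is none in the readers); parsing.
Relation to the tree: `Literature/Computation/Certificates/PsdZeroPivotRule.lean` has the three branches
over `ℝ` in `fromBlocks` form and `…/BareissFractionFreePsd.lean` the fraction-free variant's step; the
recursion and its two-sided correctness as ONE theorem about an executable function are new here, stated
over a general linearly ordered field so that the SAME function is the one `decide` runs on rational
literals (§5) and the one the theorem speaks about (§3), with §4 carrying the verdict to `ℝ`.
`Literature/Computation/Certificates/PosSemidefDecide.lean` (`PSD.LDLCert`) is the CERTIFYING cousin
(Gram factor recomputed and re-checked in the kernel; its completeness deliberately unproved there) — the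
present theorem is the two-sided statement for the REJECTING form of the same elimination (the readers'
form). References (docstring-only, no CITED-FACTS entry): R. A. Horn, C. R. Johnson, *Matrix Analysis*,
2nd ed., Obs. 7.1.10 and §7.1.P1 (zero diagonal entry ⇒ zero row/column); the Schur-complement
characterisation of semidefiniteness, e.g. Blekherman–Parrilo–Thomas (eds.), SIAM 2012, App. A.1.2;
N. J. Higham, *Accuracy and Stability of Numerical Algorithms*, 2nd ed., Ch. 10 (folklore).
-/

namespace Summit.Ventures.CertifiedQuantumChemistry

open Matrix Finset
open scoped BigOperators

namespace ExactLDL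

/-! ### §1 The quadratic form peeled at the first index -/

section Peel

variable {K : Type*} [CommRing K]

/-- **Peeling index `0`.** For any square matrix `M` on `Fin (n+1)` and `x = Fin.cons t y`,
`xᵀ M x = M₀₀ t² + t · Σ_j M_{0,j⁺} y_j + (Σ_i y_i M_{i⁺,0}) · t + yᵀ M[succ, succ] y`
(no symmetry assumed; pure bookkeeping of the double sum). [folklore] -/
theorem quadForm_cons {n : ℕ} (M : Matrix (Fin (n + 1)) (Fin (n + 1)) K) (t : K) (y : Fin n → K) :
    Fin.cons t y ⬝ᵥ (M *ᵥ Fin.cons t y) =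
      M 0 0 * t * t + t * ∑ j, M 0 j.succ * y j + (∑ i, y i * M i.succ 0) * t
        + y ⬝ᵥ (M.submatrix Fin.succ Fin.succ *ᵥ y) := by
  simp only [dotProduct, mulVec, Fin.sum_univ_succ, Fin.cons_zero, Fin.cons_succ, submatrix_apply,
    Finset.mul_sum, Finset.sum_mul, mul_add, Finset.sum_add_distrib]
  ring

/-- The quadratic form of the **Schur step** `S i j = M i⁺ j⁺ − (c i / d) · r j` against `y`:
`yᵀ S y = yᵀ M[succ,succ] y − (c·y)(r·y)/d`, where `c` is the pivot column and `r` the pivot row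
(pure algebra; `d` is only divided by, never assumed non-zero here). [folklore] -/
theorem quadForm_schur {K : Type*} [Field K] {n : ℕ} (M : Matrix (Fin (n + 1)) (Fin (n + 1)) K)
    (y : Fin n → K) :
    y ⬝ᵥ ((Matrix.of fun i j : Fin n => M i.succ j.succ - M i.succ 0 / M 0 0 * M 0 j.succ) *ᵥ y) =
      y ⬝ᵥ (M.submatrix Fin.succ Fin.succ *ᵥ y)
        - (∑ i, y i * M i.succ 0) * (∑ j, M 0 j.succ * y j) / M 0 0 := by
  have hprod : (∑ i, y i * M i.succ 0) * (∑ j, M 0 j.succ * y j) / M 0 0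
      = ∑ i, ∑ j, y i * ((M i.succ 0 / M 0 0 * M 0 j.succ) * y j) := by
    rw [Finset.sum_mul_sum, Finset.sum_div]
    refine Finset.sum_congr rfl fun i _ => ?_
    rw [Finset.sum_div]
    refine Finset.sum_congr rfl fun j _ => ?_
    ring
  rw [hprod]
  simp only [dotProduct, mulVec, of_apply, submatrix_apply, Finset.mul_sum]
  rw [← Finset.sum_sub_distrib]
  refine Finset.sum_congr rfl fun i _ => ?_
  rw [← Finset.sum_sub_distrib]
  refine Finset.sum_congr rfl fun j _ => ?_
  ring

end Peel

/-! ### §2 The three branches, two-sided, for a Hermitian matrix over a linearly ordered field -/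

section Branches

variable {K : Type*} [Field K] [LinearOrder K] [IsStrictOrderedRing K] [StarRing K] [TrivialStar K]

omit [LinearOrder K] [IsStrictOrderedRing K] in
/-- Over a trivially-starred ring, Hermitian means symmetric entrywise: `M j i = M i j`. [folklore] -/
theorem entry_comm_of_isHermitian {m : Type*} {M : Matrix m m K} (hM : M.IsHermitian) (i j : m) :
    M j i = M i j := by
  simpa only [star_trivial] using hM.apply i j

omit [IsStrictOrderedRing K] [TrivialStar K] in
/-- **Negative pivot ⇒ reject** (and correctly so): a matrix with `M 0 0 < 0` is not positive
semidefinite. [folklore] -/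
theorem not_posSemidef_of_pivot_neg {n : ℕ} {M : Matrix (Fin (n + 1)) (Fin (n + 1)) K}
    (h : M 0 0 < 0) : ¬ M.PosSemidef :=
  fun hM => (not_le.mpr h) hM.diag_nonneg

omit [LinearOrder K] [IsStrictOrderedRing K] [TrivialStar K] in
/-- The trailing minor of a Hermitian matrix is Hermitian. [folklore] -/
theorem isHermitian_minor {n : ℕ} {M : Matrix (Fin (n + 1)) (Fin (n + 1)) K} (hM : M.IsHermitian) :
    (M.submatrix Fin.succ Fin.succ).IsHermitian :=
  hM.submatrix _

omit [LinearOrder K] [IsStrictOrderedRing K] in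
/-- The Schur step of a Hermitian matrix is Hermitian (trivial star, commutative entries). [folklore] -/
theorem isHermitian_schur {n : ℕ} {M : Matrix (Fin (n + 1)) (Fin (n + 1)) K} (hM : M.IsHermitian) :
    (Matrix.of fun i j : Fin n => M i.succ j.succ - M i.succ 0 / M 0 0 * M 0 j.succ).IsHermitian := by
  refine Matrix.IsHermitian.ext fun i j => ?_
  simp only [star_trivial, of_apply, entry_comm_of_isHermitian hM i.succ j.succ,
    entry_comm_of_isHermitian hM 0 i.succ, ← entry_comm_of_isHermitian hM 0 j.succ]
  ring

/-- **Zero-pivot rule, both directions** (Horn–Johnson Obs. 7.1.10 as a decision step): for Hermitian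
`M` with `M 0 0 = 0`,  `M ⪰ 0 ↔ (the column below the pivot vanishes) ∧ (the trailing minor ⪰ 0)`.
Forward: `xᵀ M x` at `x = (t, eᵢ)` is the AFFINE function `2 t · M_{i⁺,0} + M_{i⁺,i⁺}` of `t`, bounded
below only if its slope vanishes; backward: with a zero first row and column the form is that of the
minor. [folklore] -/
theorem posSemidef_iff_of_pivot_eq_zero {n : ℕ} {M : Matrix (Fin (n + 1)) (Fin (n + 1)) K}
    (hM : M.IsHermitian) (h0 : M 0 0 = 0) :
    M.PosSemidef ↔ (∀ i : Fin n, M i.succ 0 = 0) ∧ (M.submatrix Fin.succ Fin.succ).PosSemidef := by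
  constructor
  · intro hP
    refine ⟨fun i => ?_, hP.submatrix _⟩
    by_contra hc
    -- the test vector (t, e_i) with t chosen to make the affine form equal to -1
    set t : K := -(M i.succ i.succ + 1) / (2 * M i.succ 0) with ht
    have hq := hP.dotProduct_mulVec_nonneg (Fin.cons t (Pi.single i 1))
    rw [star_trivial, quadForm_cons] at hq
    have h1 : ∑ j, M 0 j.succ * (Pi.single i (1 : K) : Fin n → K) j = M i.succ 0 := by
      rw [Finset.sum_eq_single i (fun j _ hj => by simp [hj]) (by simp)]
      simp [entry_comm_of_isHermitian hM 0 i.succ]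
    have h2 : ∑ k, (Pi.single i (1 : K) : Fin n → K) k * M k.succ 0 = M i.succ 0 := by
      rw [Finset.sum_eq_single i (fun j _ hj => by simp [hj]) (by simp)]
      simp
    have h3 : (Pi.single i (1 : K) : Fin n → K) ⬝ᵥ (M.submatrix Fin.succ Fin.succ *ᵥ Pi.single i 1)
        = M i.succ i.succ := by
      simp
    rw [h0, h1, h2, h3] at hq
    have hval : (0 : K) * t * t + t * M i.succ 0 + M i.succ 0 * t + M i.succ i.succ = -1 := by
      rw [ht]; field_simp; ring
    rw [hval] at hq
    exact absurd hq (by norm_num)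
  · rintro ⟨hc, hD⟩
    refine PosSemidef.of_dotProduct_mulVec_nonneg hM fun x => ?_
    rw [star_trivial, ← Fin.cons_self_tail x, quadForm_cons]
    have hr : ∀ j : Fin n, M 0 j.succ = 0 := fun j => by
      rw [← entry_comm_of_isHermitian hM, hc j]
    simp only [h0, hc, hr, zero_mul, mul_zero, Finset.sum_const_zero, zero_add]
    simpa only [star_trivial] using hD.dotProduct_mulVec_nonneg (Fin.tail x)

/-- **Positive pivot: continue on the Schur complement, both directions** — for Hermitian `M` with
`d = M 0 0 > 0` and `S i j = M i⁺ j⁺ − (M i⁺ 0 / d) M 0 j⁺`:  `M ⪰ 0 ↔ S ⪰ 0`.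
Completing the square, `xᵀ M x = d · (t + (c·y)/d)² + yᵀ S y` for `x = (t, y)`, `c` the pivot
column; forward takes `t = −(c·y)/d`, backward drops the square. [folklore] -/
theorem posSemidef_iff_schur_of_pivot_pos {n : ℕ} {M : Matrix (Fin (n + 1)) (Fin (n + 1)) K}
    (hM : M.IsHermitian) (hd : 0 < M 0 0) :
    M.PosSemidef ↔
      (Matrix.of fun i j : Fin n => M i.succ j.succ - M i.succ 0 / M 0 0 * M 0 j.succ).PosSemidef := by
  -- the pivot row is the pivot column (symmetry)
  have hrow : ∀ y : Fin n → K, ∑ j, M 0 j.succ * y j = ∑ i, y i * M i.succ 0 := fun y =>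
    Finset.sum_congr rfl fun j _ => by rw [entry_comm_of_isHermitian hM 0 j.succ, mul_comm]
  -- completing the square
  have hsq : ∀ (t : K) (y : Fin n → K),
      Fin.cons t y ⬝ᵥ (M *ᵥ Fin.cons t y) =
        M 0 0 * (t + (∑ i, y i * M i.succ 0) / M 0 0) * (t + (∑ i, y i * M i.succ 0) / M 0 0)
          + y ⬝ᵥ ((Matrix.of fun i j : Fin n => M i.succ j.succ - M i.succ 0 / M 0 0 * M 0 j.succ)
              *ᵥ y) := by
    intro t y
    rw [quadForm_cons, quadForm_schur, hrow]
    field_simp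
    ring
  constructor
  · intro hP
    refine PosSemidef.of_dotProduct_mulVec_nonneg (isHermitian_schur hM) fun y => ?_
    have hq := hP.dotProduct_mulVec_nonneg (Fin.cons (-((∑ i, y i * M i.succ 0) / M 0 0)) y)
    rw [star_trivial, hsq] at hq
    simpa only [star_trivial, neg_add_cancel, mul_zero, zero_add] using hq
  · intro hS
    refine PosSemidef.of_dotProduct_mulVec_nonneg hM fun x => ?_
    rw [star_trivial, ← Fin.cons_self_tail x, hsq]
    have h1 : 0 ≤ M 0 0 * (x 0 + (∑ i, Fin.tail x i * M i.succ 0) / M 0 0)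
        * (x 0 + (∑ i, Fin.tail x i * M i.succ 0) / M 0 0) := by
      rw [mul_assoc]; exact mul_nonneg hd.le (mul_self_nonneg _)
    have h2 := hS.dotProduct_mulVec_nonneg (Fin.tail x)
    rw [star_trivial] at h2
    exact add_nonneg h1 h2

end Branches

/-! ### §3 The routine and its decision theorem -/

section Decide

variable {K : Type*} [Field K] [LinearOrder K]

/-- **`ldl_psd`, structurally.** Exact pivoting-free `LDLᵀ` acceptance with the zero-pivot rule, by
recursion on the dimension (peel index `0`): reject a negative pivot; at a zero pivot require the column
below it to vanish and continue on the trailing minor; at a positive pivot continue on the Schur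
complement `S i j = M i⁺ j⁺ − (M i⁺ 0 / M 0 0) · M 0 j⁺` (the reader's `B[i][j] -= f*B[k][j]`,
`f = B[i][k]/d`, restricted to the trailing block it will read again). Executable (`decide`) on literal
data over `ℚ`; meaningful (§3–§4) over any linearly ordered field. [folklore] -/
def ldlAccept : (n : ℕ) → Matrix (Fin n) (Fin n) K → Bool
  | 0, _ => true
  | n + 1, M =>
    if M 0 0 < 0 then false
    else if M 0 0 = 0 then
      decide (∀ i : Fin n, M i.succ 0 = 0) && ldlAccept n (M.submatrix Fin.succ Fin.succ)
    else
      ldlAccept n (Matrix.of fun i j : Fin n => M i.succ j.succ - M i.succ 0 / M 0 0 * M 0 j.succ)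

/-- Unfolding equations of `ldlAccept` (by `rfl`). [folklore] -/
theorem ldlAccept_zero (M : Matrix (Fin 0) (Fin 0) K) : ldlAccept 0 M = true := rfl

/-- Unfolding equation at a successor dimension (by `rfl`). [folklore] -/
theorem ldlAccept_succ {n : ℕ} (M : Matrix (Fin (n + 1)) (Fin (n + 1)) K) :
    ldlAccept (n + 1) M =
      if M 0 0 < 0 then false
      else if M 0 0 = 0 then
        decide (∀ i : Fin n, M i.succ 0 = 0) && ldlAccept n (M.submatrix Fin.succ Fin.succ)
      else
        ldlAccept n
          (Matrix.of fun i j : Fin n => M i.succ j.succ - M i.succ 0 / M 0 0 * M 0 j.succ) := rfl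

variable [StarRing K] [TrivialStar K]

/-- A `0 × 0` matrix is positive semidefinite. [folklore] -/
theorem posSemidef_fin_zero (M : Matrix (Fin 0) (Fin 0) K) : M.PosSemidef :=
  PosSemidef.of_dotProduct_mulVec_nonneg (Matrix.IsHermitian.ext fun i => Fin.elim0 i) fun x => by
    simp [dotProduct]

variable [IsStrictOrderedRing K]

/-- **DECISION THEOREM.** For a Hermitian matrix over a linearly ordered field (trivial star), the
exact pivoting-free `LDLᵀ` routine with the zero-pivot rule ACCEPTS IFF the matrix is positive
semidefinite. Induction on the dimension through the three branches of §2. [folklore] -/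
theorem ldlAccept_iff_posSemidef :
    ∀ (n : ℕ) (M : Matrix (Fin n) (Fin n) K), M.IsHermitian → (ldlAccept n M = true ↔ M.PosSemidef)
  | 0, M, _ => by simpa [ldlAccept_zero] using posSemidef_fin_zero M
  | n + 1, M, hM => by
    rw [ldlAccept_succ]
    by_cases hneg : M 0 0 < 0
    · simpa [hneg] using not_posSemidef_of_pivot_neg hneg
    by_cases h0 : M 0 0 = 0
    · rw [if_neg hneg, if_pos h0, Bool.and_eq_true, decide_eq_true_iff,
        ldlAccept_iff_posSemidef n _ (isHermitian_minor hM), posSemidef_iff_of_pivot_eq_zero hM h0]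
    · have hd : 0 < M 0 0 := lt_of_le_of_ne (not_lt.mp hneg) (Ne.symm h0)
      rw [if_neg hneg, if_neg h0, ldlAccept_iff_posSemidef n _ (isHermitian_schur hM),
        ← posSemidef_iff_schur_of_pivot_pos hM hd]

/-- **Soundness as the readers use it**: an accepted Hermitian (= symmetric, built so by the readers)
matrix is positive semidefinite. [folklore] -/
theorem posSemidef_of_ldlAccept {n : ℕ} {M : Matrix (Fin n) (Fin n) K} (hM : M.IsHermitian)
    (h : ldlAccept n M = true) : M.PosSemidef :=
  (ldlAccept_iff_posSemidef n M hM).mp h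

/-- **Completeness**: a positive semidefinite matrix is accepted — so `False` on symmetric input is a
REFUTATION of semidefiniteness, not a failed factorisation attempt. [folklore] -/
theorem ldlAccept_of_posSemidef {n : ℕ} {M : Matrix (Fin n) (Fin n) K} (h : M.PosSemidef) :
    ldlAccept n M = true :=
  (ldlAccept_iff_posSemidef n M h.1).mpr h

/-- Contrapositive reading of a `False` verdict on Hermitian input. [folklore] -/
theorem not_posSemidef_of_ldlAccept_eq_false {n : ℕ} {M : Matrix (Fin n) (Fin n) K}
    (h : ldlAccept n M = false) : ¬ M.PosSemidef :=
  fun hP => Bool.false_ne_true (h ▸ ldlAccept_of_posSemidef hP)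

end Decide

/-! ### §4 Invariance under ordered-field embeddings; the rational run decides the real matrix -/

section Map

variable {K L : Type*} [Field K] [LinearOrder K] [Field L] [LinearOrder L]

/-- **The verdict only sees field operations and signs**: for a strictly monotone ring homomorphism
`f : K →+* L` of linearly ordered fields (e.g. `ℚ ⊂ ℚ(√2) ⊂ ℝ`), `ldlAccept (M.map f) = ldlAccept M`.
[folklore] -/
theorem ldlAccept_map (f : K →+* L) (hf : StrictMono f) :
    ∀ (n : ℕ) (M : Matrix (Fin n) (Fin n) K), ldlAccept n (M.map f) = ldlAccept n M
  | 0, _ => rfl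
  | n + 1, M => by
    have hlt : ∀ a : K, f a < 0 ↔ a < 0 := fun a => by
      simpa only [map_zero] using hf.lt_iff_lt (a := a) (b := 0)
    have heq : ∀ a : K, f a = 0 ↔ a = 0 := fun a => by
      simpa only [map_zero] using hf.injective.eq_iff (a := a) (b := 0)
    rw [ldlAccept_succ, ldlAccept_succ]
    simp only [map_apply, hlt, heq]
    have h1 : (M.map f).submatrix Fin.succ Fin.succ = (M.submatrix Fin.succ Fin.succ).map f := rfl
    have h2 : (Matrix.of fun i j : Fin n =>
          f (M i.succ j.succ) - f (M i.succ 0) / f (M 0 0) * f (M 0 j.succ)) =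
        (Matrix.of fun i j : Fin n => M i.succ j.succ - M i.succ 0 / M 0 0 * M 0 j.succ).map f := by
      ext i j
      simp only [of_apply, map_apply, map_sub, map_mul, map_div₀]
    rw [h1, h2, ldlAccept_map f hf n, ldlAccept_map f hf n]

/-- The rational run equals the real run on the cast matrix. [folklore] -/
theorem ldlAccept_map_ratCast (n : ℕ) (M : Matrix (Fin n) (Fin n) ℚ) :
    ldlAccept n (M.map (Rat.cast : ℚ → ℝ)) = ldlAccept n M :=
  ldlAccept_map (Rat.castHom ℝ) Rat.cast_strictMono n M

/-- **What the checker's rational fast path decides**: for a SYMMETRIC rational matrix, the routine run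
in exact rational arithmetic accepts iff the REAL matrix `M.map Rat.cast` is positive semidefinite — the
hypothesis `Rows/ExactEnclosureCertificate.lean` consumes for every primal block and every dual `Z`.
[folklore] -/
theorem ldlAccept_iff_posSemidef_real {n : ℕ} (M : Matrix (Fin n) (Fin n) ℚ) (hM : M.IsSymm) :
    ldlAccept n M = true ↔ (M.map (Rat.cast : ℚ → ℝ)).PosSemidef := by
  rw [← ldlAccept_map_ratCast]
  exact ldlAccept_iff_posSemidef n _ (Matrix.isHermitian_iff_isSymm.mpr (hM.map _))

/-- Corollary: for a symmetric rational matrix, positive semidefiniteness over `ℚ` and over `ℝ` (of the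
cast) are the same thing — both are decided by the same run. [folklore] -/
theorem posSemidef_rat_iff_real {n : ℕ} (M : Matrix (Fin n) (Fin n) ℚ) (hM : M.IsSymm) :
    M.PosSemidef ↔ (M.map (Rat.cast : ℚ → ℝ)).PosSemidef := by
  rw [← ldlAccept_iff_posSemidef_real M hM,
    ldlAccept_iff_posSemidef n M (Matrix.isHermitian_iff_isSymm.mpr hM)]

end Map

/-! ### §5 Kernel-checked examples (every branch) -/

section Examples

/-- Rank-one `[[1,2],[2,4]]`: positive pivot, then a zero pivot with nothing below — accepted. -/
example : ldlAccept (K := ℚ) 2 !![1, 2; 2, 4] = true := by decide +kernel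

/-- `[[1,2],[2,3]]`: the Schur step gives the pivot `3 − 4 = −1 < 0` — rejected. -/
example : ldlAccept (K := ℚ) 2 !![1, 2; 2, 3] = false := by decide +kernel

/-- Zero leading pivot with a vanishing column, then a rank-one minor — accepted. -/
example : ldlAccept (K := ℚ) 3 !![0, 0, 0; 0, 1, 1; 0, 1, 1] = true := by decide +kernel

/-- Zero leading pivot with a NON-vanishing column (the zero-pivot rule bites) — rejected, although
every principal MINOR of this matrix through the leading corner is `0 ≥ 0`. -/
example : ldlAccept (K := ℚ) 3 !![0, 0, 1; 0, 1, 1; 1, 1, 1] = false := by decide +kernel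

/-- The decision theorem applied to a literal: `[[2,-1,0],[-1,2,-1],[0,-1,2]] ⪰ 0` over `ℝ`. -/
example : ((!![2, -1, 0; -1, 2, -1; 0, -1, 2] : Matrix (Fin 3) (Fin 3) ℚ).map
    (Rat.cast : ℚ → ℝ)).PosSemidef :=
  (ldlAccept_iff_posSemidef_real _ (by decide +kernel)).mp (by decide +kernel)

end Examples

end ExactLDL

end Summit.Ventures.CertifiedQuantumChemistry
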